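import Summits.AtomisticToContinuum.HydrodynamicLimit.Theorems.JParityClosureLocalSecondLawEquilibriumDefs
import Summits.AtomisticToContinuum.HydrodynamicLimit.Theorems.JParityClosureOddContactSymmetryGibbsInvariance
import Summits.AtomisticToContinuum.HydrodynamicLimit.Theorems.JParityClosureLocalSecondLawRegularRangeTools
import Summits.AtomisticToContinuum.HydrodynamicLimit.Theorems.JParityClosureDensityCapMeanDisplacement
import Summits.AtomisticToContinuum.HydrodynamicLimit.Theorems.JParityClosureEvenStressEnskogKineticEnergyTight

/-!
# Equilibrium stub E9 `eq_supDensity`: a good orbit of the homogeneous law rarely has coarse density `> 2`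

Registered stub of the equilibrium side-composition of line `exact-entropy-ledger-three-passivities` for the crux
`JParityClosure.LocalSecondLaw` (stmt-AtomisticToContinuum-13081, lead c2).  HYPOTHESIS: the uniform-in-`x` static
density law of large numbers at `(σ, r)` under the homogeneous local Gibbs law `lawC σ a Θ ū N Φ` (for every
tolerance `ι` and confidence `δ'`, eventually in `N`, off a measurable set of law `≤ δ'` the coarse density `ρ_r(w)(x)`
is `ι`-close to `1` at every `x`).  CONCLUSION: eventually in `N`, the event that a good orbit has `ρ_r(Φₛz)(x) > 2`
at some `(s, x) ∈ [0, τ] × 𝕋³` has law `≤ δ`.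

Proof (step (3) of the lead's composition): (i) the coarse density is Lipschitz in time along good orbits through
the conserved kinetic energy, `|ρ_r(Φₛz)(x) − ρ_r(Φₖz)(x)| ≤ 3/(πr⁴) √(2 (N+1)⁻¹E(z)) |s − k|` (mean displacement
bound `stub_meanDisplacement` + kernel Lipschitz bound `gridUp_clock`); (ii) the kinetic energy per particle has a
uniform-in-`N` tail under the homogeneous law (`localGibbsMeasure_energyPerParticle_tail_le`, Bienaymé–Chebyshev
conditionally on the positions); (iii) a finite time net of `[0, τ]` of mesh `δt` with `3/(πr⁴) √(2K) δt ≤ 1/2`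
(`gridUp_timeNet`), the hypothesis at tolerance `1/2` transported to every net time by invariance of the homogeneous
law (`localGibbsLaw_const_preimage_flow`), and the union bound.  Off the exceptional events, at every `(s, x)`:
`ρ_r ≤ 1 + 1/2 + 1/2 = 2`.

References: H. Spohn, *Large Scale Dynamics of Interacting Particles* (1991), Part I §2.3 (homogeneous Gibbs law,
stationarity); C. Kipnis, C. Landim, *Scaling Limits of Interacting Particle Systems* (1999), Ch. 4 (from fixed-time
to uniform-in-time statements through a modulus of continuity and a finite net).
-/

noncomputable section

namespace Summit.AtomisticToContinuum.HydrodynamicLimit.Theorems.LocalSecondLawEquilibrium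

open scoped BigOperators Topology Classical MeasureTheory ENNReal InnerProductSpace
open Filter Set MeasureTheory
open Literature.MathematicalPhysics.KineticTheory
open Literature.Analysis.FluidPDE
open Summit.AtomisticToContinuum.HydrodynamicLimit.Theorems.LocalSecondLawNegative
open Summit.AtomisticToContinuum.HydrodynamicLimit.Theorems.LocalSecondLawLedger

variable {N : ℕ}

/-- **Density clock along good orbits**: the coarse density is Lipschitz in time through the conserved kinetic
energy, `|ρ_r(Φₛz)(x) − ρ_r(Φₖz)(x)| ≤ 3/(πr⁴) · √(2 (N+1)⁻¹ E(z)) · |s − k|` (mean displacement bound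
`stub_meanDisplacement` and the kernel Lipschitz bound `gridUp_clock`). -/
theorem supD_clock {σ r : ℝ} (hr : 0 < r) (Φ : Flow σ N) {z : Phase N} (hz : z ∈ Φ.good) (k s : ℝ)
    (x : T3) :
    |rhoC r (Φ.flow s z) x - rhoC r (Φ.flow k z) x| ≤
      3 / (Real.pi * r ^ 4) * Real.sqrt (2 * (((N + 1 : ℕ) : ℝ)⁻¹ * configEnergy z)) * |s - k| :=
  gridUp_clock hr Φ (stub_meanDisplacement Φ hz) k s x

/-- **Uniform energy tail under the homogeneous law**: for every `δ > 0` there is a level `K ≥ 0` with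
`lawC {K < (N+1)⁻¹ E} ≤ δ` for every `N` and every flow (`localGibbsMeasure_energyPerParticle_tail_le` with
`η = B/δ + 1`, `K = K₀ + η`; the law does not depend on the flow, `localGibbsLaw_eq`). -/
theorem supD_energy_tail {a Θ σ : ℝ} (ū : V3) (ha : 0 < a) (hΘ : 0 < Θ) (hσ2 : σ ≤ 1 / 2) {δ : ℝ}
    (hδ : 0 < δ) :
    ∃ K : ℝ, 0 ≤ K ∧ ∀ (N : ℕ) (Φ : Flow σ N),
      lawC σ a Θ ū N Φ {z | K < ((N + 1 : ℕ) : ℝ)⁻¹ * configEnergy z} ≤ ENNReal.ofReal δ := by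
  obtain ⟨K₀, B, hK₀, hB, htail⟩ :=
    EvenStressEnskog.localGibbsMeasure_energyPerParticle_tail_le (a₀ := fun _ => a) (θ₀ := fun _ => Θ)
      (u₀ := fun _ => ū) continuous_const continuous_const continuous_const (fun _ => ha) (fun _ => hΘ) hσ2
  have hη : 0 < B / δ + 1 := by positivity
  refine ⟨K₀ + (B / δ + 1), by positivity, fun N Φ => ?_⟩
  have hset : {z : Phase N | K₀ + (B / δ + 1) < ((N + 1 : ℕ) : ℝ)⁻¹ * configEnergy z} =
      {z | K₀ + (B / δ + 1) < ((N : ℝ) + 1)⁻¹ * configEnergy z} := by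
    simp only [Nat.cast_add_one]
  rw [hset, show lawC σ a Θ ū N Φ = localGibbsMeasure σ (fun _ => a) (fun _ => ū) (fun _ => Θ) N from
    localGibbsLaw_eq σ _ _ _ N Φ]
  refine (htail (B / δ + 1) hη N).trans (ENNReal.ofReal_le_ofReal ?_)
  have hN : (1 : ℝ) ≤ ((N + 1 : ℕ) : ℝ) := by exact_mod_cast Nat.succ_pos N
  rw [div_le_iff₀ (by positivity)]
  calc B = B / δ * δ := (div_mul_cancel₀ B hδ.ne').symm
    _ ≤ (B / δ + 1) ^ 2 * δ := by
        gcongr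
        nlinarith [div_nonneg hB hδ.le]
    _ ≤ ((N + 1 : ℕ) : ℝ) * (B / δ + 1) ^ 2 * δ := by
        gcongr
        exact le_mul_of_one_le_left (sq_nonneg _) hN
    _ = δ * (((N + 1 : ℕ) : ℝ) * (B / δ + 1) ^ 2) := by ring

/-- **E9 · the sup-density event is rare at equilibrium** (registered stub `eq_supDensity` of the equilibrium
side-composition of line `exact-entropy-ledger-three-passivities`).  Given the uniform-in-`x` static density law of
large numbers at `(σ, r)` under the homogeneous law, for every `δ > 0`, eventually in `N`, the event that a good orbit
has coarse density `> 2` at some `(s, x) ∈ [0, τ] × 𝕋³` has law `≤ δ`: density clock (`supD_clock`), energy tail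
(`supD_energy_tail`), finite time net (`gridUp_timeNet`) with `3/(πr⁴)√(2K)δt ≤ 1/2`, the hypothesis at tolerance
`1/2` transported to the net times by flow-invariance of the homogeneous law (`localGibbsLaw_const_preimage_flow`),
union bound. -/
theorem eq_supDensity :
  ∀ (a Θ σ r τ : ℝ) (ū : V3), 0 < a → 0 < Θ → 0 < σ → σ ≤ 1 / 2 → 0 < r → 0 < τ →
    (∀ ι δ' : ℝ, 0 < ι → 0 < δ' → ∃ N₀ : ℕ, ∀ N : ℕ, N₀ ≤ N → ∀ Φ : Flow σ N,
      ∃ B : Set (Phase N), MeasurableSet B ∧ lawC σ a Θ ū N Φ B ≤ ENNReal.ofReal δ' ∧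
        ∀ w, w ∉ B → ∀ x : T3, |rhoC r w x - 1| < ι) →
    ∀ δ : ℝ, 0 < δ → ∃ N₀ : ℕ, ∀ N : ℕ, N₀ ≤ N → ∀ Φ : Flow σ N,
      lawC σ a Θ ū N Φ {z | z ∈ Φ.good ∧ ∃ s ∈ Set.Icc (0 : ℝ) τ, ∃ x : T3, 2 < rhoC r (Φ.flow s z) x}
        ≤ ENNReal.ofReal δ := by
  intro a Θ σ r τ ū ha hΘ _hσ hσ2 hr _hτ hLLN δ hδ
  -- (ii) the energy level, confidence `δ/2`
  obtain ⟨K, hK0, hKtail⟩ := supD_energy_tail ū ha hΘ hσ2 (half_pos hδ)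
  -- (iii) the time net: mesh `δt` with `L √(2K) δt ≤ 1/2`
  set L : ℝ := 3 / (Real.pi * r ^ 4) with hLdef
  have hL : 0 < L := by positivity
  set V : ℝ := Real.sqrt (2 * K) with hVdef
  have hV : 0 ≤ V := Real.sqrt_nonneg _
  set δt : ℝ := 1 / (2 * L * (V + 1)) with hδtdef
  have hδt : 0 < δt := by positivity
  have hδt₂ : L * V * δt ≤ 1 / 2 := by
    have hne : L * (V + 1) ≠ 0 := by positivity
    calc L * V * δt ≤ L * (V + 1) * δt := by gcongr; linarith
      _ = 1 / 2 := by rw [hδtdef]; field_simp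
  obtain ⟨St, -, hSt'⟩ := gridUp_timeNet τ hδt
  -- the static LLN at tolerance `1/2` and confidence `δ' = δ / (2 (#St + 1))`
  set δ' : ℝ := δ / (2 * ((St.card : ℝ) + 1)) with hδ'def
  have hδ' : 0 < δ' := by positivity
  obtain ⟨N₀, hN₀⟩ := hLLN (1 / 2) δ' one_half_pos hδ'
  refine ⟨N₀, fun N hN Φ => ?_⟩
  obtain ⟨B, hBm, hBlaw, hBoff⟩ := hN₀ N hN Φ
  -- the sure inclusion: off the transported LLN events and the energy event, `ρ_r ≤ 2` on `[0, τ] × 𝕋³`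
  have hsub : {z : Phase N | z ∈ Φ.good ∧ ∃ s ∈ Set.Icc (0 : ℝ) τ, ∃ x : T3, 2 < rhoC r (Φ.flow s z) x} ⊆
      (⋃ k ∈ St, Φ.flow k ⁻¹' B) ∪ {z | K < ((N + 1 : ℕ) : ℝ)⁻¹ * configEnergy z} := by
    rintro z ⟨hz, s, hs, x, hx⟩
    by_cases hKz : ((N + 1 : ℕ) : ℝ)⁻¹ * configEnergy z ≤ K
    · obtain ⟨k, hk, hsk⟩ := hSt' s hs
      refine Or.inl (mem_iUnion₂.2 ⟨k, hk, ?_⟩)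
      by_contra hnot
      have h1 : |rhoC r (Φ.flow k z) x - 1| < 1 / 2 := hBoff _ hnot x
      have hclock : |rhoC r (Φ.flow s z) x - rhoC r (Φ.flow k z) x| ≤
          L * Real.sqrt (2 * (((N + 1 : ℕ) : ℝ)⁻¹ * configEnergy z)) * |s - k| :=
        supD_clock hr Φ hz k s x
      have h2 : |rhoC r (Φ.flow s z) x - rhoC r (Φ.flow k z) x| ≤ 1 / 2 :=
        hclock.trans ((capSub_clock_mono hL.le hKz hsk).trans hδt₂)
      have h3 := (abs_sub_lt_iff.1 h1).1
      have h4 := (abs_le.1 h2).2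
      linarith
    · exact Or.inr (not_le.1 hKz)
  -- the union bound
  have hpre : ∀ k ∈ St, lawC σ a Θ ū N Φ (Φ.flow k ⁻¹' B) ≤ ENNReal.ofReal δ' := fun k _ => by
    rw [show lawC σ a Θ ū N Φ (Φ.flow k ⁻¹' B) = lawC σ a Θ ū N Φ B from
      localGibbsLaw_const_preimage_flow σ a Θ ū N Φ k hBm]
    exact hBlaw
  have hcard : (St.card : ℝ) * δ' ≤ δ / 2 := by
    have hc : (0 : ℝ) ≤ St.card := Nat.cast_nonneg _
    have hne : (St.card : ℝ) + 1 ≠ 0 := by positivity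
    calc (St.card : ℝ) * δ' ≤ ((St.card : ℝ) + 1) * δ' := by gcongr; linarith
      _ = δ / 2 := by rw [hδ'def]; field_simp
  have hU : lawC σ a Θ ū N Φ (⋃ k ∈ St, Φ.flow k ⁻¹' B) ≤ ENNReal.ofReal (δ / 2) := by
    calc lawC σ a Θ ū N Φ (⋃ k ∈ St, Φ.flow k ⁻¹' B)
        ≤ ∑ k ∈ St, lawC σ a Θ ū N Φ (Φ.flow k ⁻¹' B) := measure_biUnion_finset_le St _
      _ ≤ ∑ k ∈ St, ENNReal.ofReal δ' := Finset.sum_le_sum hpre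
      _ = ENNReal.ofReal ((St.card : ℝ) * δ') := by
          rw [Finset.sum_const, nsmul_eq_mul, ← ENNReal.ofReal_natCast,
            ← ENNReal.ofReal_mul (Nat.cast_nonneg _)]
      _ ≤ ENNReal.ofReal (δ / 2) := ENNReal.ofReal_le_ofReal hcard
  calc lawC σ a Θ ū N Φ {z | z ∈ Φ.good ∧ ∃ s ∈ Set.Icc (0 : ℝ) τ, ∃ x : T3, 2 < rhoC r (Φ.flow s z) x}
      ≤ lawC σ a Θ ū N Φ ((⋃ k ∈ St, Φ.flow k ⁻¹' B) ∪ {z | K < ((N + 1 : ℕ) : ℝ)⁻¹ * configEnergy z}) :=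
        measure_mono hsub
    _ ≤ lawC σ a Θ ū N Φ (⋃ k ∈ St, Φ.flow k ⁻¹' B) +
          lawC σ a Θ ū N Φ {z | K < ((N + 1 : ℕ) : ℝ)⁻¹ * configEnergy z} := measure_union_le _ _
    _ ≤ ENNReal.ofReal (δ / 2) + ENNReal.ofReal (δ / 2) := add_le_add hU (hKtail N Φ)
    _ = ENNReal.ofReal δ := by
        rw [← ENNReal.ofReal_add (by positivity) (by positivity), add_halves]

end Summit.AtomisticToContinuum.HydrodynamicLimit.Theorems.LocalSecondLawEquilibrium

end
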